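import Mathlib
import HarnessLib
import Summits.HubbardSuperconductivity.HubbardSuperconductivity.Theorems.KLProgrammeKLRegimeEngineScaleOneSrcPackageWDoors
import Summits.HubbardSuperconductivity.HubbardSuperconductivity.Theorems.KLProgrammeKLRegimeTwoVolumeSourceProfileDefsF

/-!
# Route `KLProgramme` — K3 VL child (stmt-HubbardSuperconductivity-23356), atom HUV-W, LEVEL 0 IN THE LEAD'S CURRENCY:
# `SourceProfilesAtLevF L M (klSrcBudget P Q U (fun _ _ => A₀) 1) β U μ K (srcWindowFamily L M) 0 0 1` (cell gate-hubbard-kl, seat p3 g21)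

The VL lead's family-generic carriers (`…TwoVolumeSourceProfileDefsF`, located point LR13′) key token #24 at a source family `F`; HUV-W is the
case `F = srcWindowFamily L M`, where `klSrcAnalysisAtF … (srcWindowFamily L M) J = klSrcAnalysisAtW … J` by `rfl`.  The species-`s` pinned sums
`klSrcPinnedSumAtF … (srcWindowFamily L M) 0 0 1 s m q w` are sub-sums of the all-species windowed level-`0` pinned fibre bounded in
`…EngineScaleOneSrcPackageWDoors`; this file is the three-line keying:

* `klSrcPinnedSumAtF_srcWindow_le_of_fibre` — any bound on every pinned sub-sum of the windowed fibre of `𝒱⁽ⁿ⁾` bounds the species sums;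
* **`sourceProfilesAtLevF_srcWindow_zero_of_le_CE`** — level `0` of HUV-W under the doors (`srcPinnedSumW_one_klSrcBudget_of_le_CE` re-keyed);
* **`exists_sourceProfilesAtLevF_srcWindow_zero`** — the packaged FRAME-GENERIC form: `∀ P R, WF → ∃ CE₀ ≥ 0, ∃ c₀ > 0, ∀ c ≤ c₀, ∃ U₀ > 0,
  ∀ μ U β (regime), ∃ A₀ ≥ 1, ∀ L M ≥ (klEngL₃, klEngM₃), ∀ K, FrameOK R U (nScales β) μ K → ∀ Q, CE₀ ≤ Q.CE →
  SourceProfilesAtLevF L M (klSrcBudget P Q U (fun _ _ => A₀) 1) β U μ K (srcWindowFamily L M) 0 0 1`.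

Level `0` only (the level-`1` clause of the atom is a separate file).  Proofs only; nothing asserts HUV, any stub, VL, K3 or superconductivity.
[cite: BenfattoGiulianiMastropietro2006, §2.9 (4.3)–(4.8), §3 (3.2)–(3.8)]
-/

noncomputable section

namespace Summit.HubbardSuperconductivity.HubbardSuperconductivity.Theorems.EngineV8

set_option linter.dupNamespace false -- summit = problem name (single-conjunct summit), D-0017

open Real Finset Complex Literature.MathematicalPhysics.QuantumLattice Literature.Probability.LatticeModels Literature.MathematicalPhysics.QuantumLattice.GrassmannAlgebra
open Summit.HubbardSuperconductivity.HubbardSuperconductivity.Theorems.KLRegimeSplit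
open Summit.HubbardSuperconductivity.HubbardSuperconductivity.Theorems.KLProgrammeLegKernels
open Summit.HubbardSuperconductivity.HubbardSuperconductivity.Theorems.TwoVolumeSource
open scoped ComplexConjugate

variable {L M : ℕ} [NeZero L]

/-- **Species sums are sub-sums of the windowed fibre**: a bound `B m` on every pinned sub-sum of the windowed doubled fibre of `𝒱⁽ⁿ⁾` (alive family `F_J`,
rate `r`) bounds `klSrcPinnedSumAtF … (srcWindowFamily L M) J r n s m q w` for every species count `s`. -/
theorem klSrcPinnedSumAtF_srcWindow_le_of_fibre {β U μ : ℝ} {K : TrigPolyC4v} {J r n : ℕ} {B : ℕ → ℕ → ℝ}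
    (h : ∀ (s m : ℕ) (q : Fin m) (w : SrcLabel L M J) (S : Finset (Fin m → SrcLabel L M J)),
      S ⊆ univ.filter (fun X : Fin m → SrcLabel L M J => X q = w) →
      imagTimeWeight β M ^ (m - 1) *
        ∑ X ∈ S, klScaleWt L M β r ((univ.image X).image (srcLegPos L M (2 * (2 * M)))) *
            ‖kernel ℂ (ExteriorAlgebra.map (Matrix.toLin' (klSrcAnalysisAtW L M β μ K J)) (klEffectiveAction L M β U μ K klE0 n)) m X‖ ≤ B s m)
    (s m : ℕ) (q : Fin m) (w : SrcLabel L M J) :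
    klSrcPinnedSumAtF L M β U μ K (srcWindowFamily L M) J r n s m q w ≤ B s m := by
  classical
  rw [klSrcPinnedSumAtF_def]
  exact h s m q w _ fun X hX => by
    rw [Finset.mem_filter] at hX ⊢
    exact ⟨hX.1, hX.2.1⟩

/-- **HUV-W LEVEL 0 in the lead's currency, under the doors** `c ≤ klEngC₃6 P R`, `U ≤ klEngU₀6 P R c`: for every bracket majorant `Ā ≥ 1` with its two
smallness conditions, every `Q` with `32·e⁹·t_W²·Ā ≤ Q.CE` and every `A₀ ≥ max 1 (2t_W²(e⁵k̄K + 4e⁹κ₁²|U|))`: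
`SourceProfilesAtLevF L M (klSrcBudget P Q U (fun _ _ => A₀) 1) β U μ K (srcWindowFamily L M) 0 0 1` at every admissible frame `K`.
[cite: BenfattoGiulianiMastropietro2006, §2.9 (4.3)–(4.8), §3 (3.2)–(3.8)] -/
theorem sourceProfilesAtLevF_srcWindow_zero_of_le_CE {C_T : ℝ} (hCT0 : 0 ≤ C_T)
    (hCT : ∀ (L M : ℕ) [NeZero L] [NeZero M] (R : RenConsts) (U : ℝ) (N : ℕ) (μ : ℝ) (K : TrigPolyC4v),
      FrameOK R U N μ K → (∀ j, 0 ≤ R.Gfr j) → μ ∈ klWindowC → 16 / 15 * (R.Gfr 0 * |U|) ≤ 1 / 50 → (2 : ℝ) ^ 15 ≤ L →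
      ∀ β : ℝ, klBetaMin ≤ β → β ≤ M → klE0 * β ≤ Real.pi * (2 * M - 13) →
      ∀ (ω : Fin (sectorCount 0)) (c : Fin 2),
        1 / (|β| * (L : ℝ) ^ 2) *
            ∑ dw : TorusSite 1 (2 * (2 * M)) × TorusSite 2 L,
              (β / (2 * (2 * M) : ℕ) * cyclicDist (2 * (2 * M)) (dw.1 0) 0) *
                ‖∑ k : FreqMomentum L M, klAnisoFamily L M β μ K klE0 0 ω k *
                  (if c = 0 then torusChar (fun _ : Fin 1 => ((k.1 : ℕ) : ZMod (2 * (2 * M)))) dw.1 * torusChar k.2 dw.2 else conj (torusChar (fun _ : Fin 1 => ((k.1 : ℕ) : ZMod (2 * (2 * M)))) dw.1 * torusChar k.2 dw.2))‖ ≤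
          C_T * (M / β))
    {c₂ : ℝ} (hc₂ : ∀ x : ℝ, |iteratedDeriv 2 srcWindowFn x| ≤ c₂)
    (P : SplitConsts) (R : RenConsts) (c : ℝ) (hP : P.WF) (hR : R.WF2) (hc : 0 < c) (hc₆ : c ≤ klEngC₃6 P R)
    (μ : ℝ) (hμ : μ ∈ klWindowC) (U : ℝ) (hU : 0 < U) (hU₆ : U ≤ klEngU₀6 P R c) (β : ℝ) (hβ : klBetaMin ≤ β)
    (hβc : β ≤ Real.exp (c / U ^ 2)) (K : TrigPolyC4v) (hK : FrameOK R U (nScales β) μ K) (L M : ℕ) [NeZero L] [NeZero M]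
    (hL : klEngL₃ β U ≤ L) (hM : klEngM₃ β U L ≤ M)
    {Abar : ℝ} (hAbar1 : 1 ≤ Abar)
    (hAbar : (14 * Real.sqrt ((1 / 2 + 12 / klScale klE0 1) *
            (2 / klScale klE0 1 + 128 * Real.pi ^ 4 * (4 * (1110 : ℝ) + 6 * (32 / 3) + 2) ^ 2 / klScale klE0 1 +
              2 * Real.pi ^ 5 * (4 * (1110 : ℝ) + 6 * (32 / 3) + 2) ^ 2 / klScale klE0 1 ^ 2 + 1 +
              Real.pi ^ 4 * ((7 : ℝ) ^ 2 * (4 * (1110 : ℝ) + 6 * (32 / 3) + 2) * (2 / klScale klE0 1) + 7 * (2 * (32 / 3) + 1)) ^ 2 /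
                klScale klE0 1 ^ 3))) + uvTimeMomentConst (klScale klE0 1) 7 32 +
        2 * (uvSpaceMomentConst (klScale klE0 1) 1 (uvPieceSq (klScale klE0 1) (uvBaseQ klCutoffX5 (klScale klE0 1) 4) (uvBaseQ' klCutoffX5 (klScale klE0 1) 4)) +
          (1 / 4 * Real.sqrt (216 * (1 / klScale klE0 1 + 1 / 2)) *
              ∑ e : Fin 2 × Fin 2, (uvLinV (klScale klE0 1) (1 + (e.1 : ℕ) + (e.2 : ℕ)) *
                  (klCutoffX5 * ((1 + ((e.1 : ℕ) + (e.2 : ℕ)) + 2).factorial : ℝ) * (4 / klScale klE0 1) ^ (1 + ((e.1 : ℕ) + (e.2 : ℕ)) + 1)) +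
                uvLinD (klScale klE0 1) (1 + (e.1 : ℕ) + (e.2 : ℕ)) *
                  (klCutoffX5 * ((1 + ((e.1 : ℕ) + (e.2 : ℕ)) + 3).factorial : ℝ) * (4 / klScale klE0 1) ^ (1 + ((e.1 : ℕ) + (e.2 : ℕ)) + 2)))) *
            (4608 * (1 + R.Gfr 0 + R.Gfr 1 + R.Gfr 2 + R.Gfr 3) ^ 4 * ((((nScales β : ℕ) : ℝ) + 1) * U ^ 2 + 2 * |U|))) ≤ Abar)
    (hθ1 : 16 * Real.exp 1 ^ 5 * Abar * (klE4KapF R * |U| + 2 * (c / Real.log 4) * klE4Mom R) ≤ 1)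
    (hθ2 : 64 * Real.exp 1 ^ 9 * (Real.sqrt (2 * (7 + 6047)) + Real.sqrt 6047) ^ 2 * Abar * |U| ≤ 1)
    (Q : EngConsts) (hCE : 32 * Real.exp 1 ^ 9 * (2 * klIsoT + C_T + 8 * (klE4X0 + 1) + (2 + 72 * c₂)) ^ 2 * Abar ≤ Q.CE)
    {A₀ : ℝ} (hA₀ : max 1 (2 * (2 * klIsoT + C_T + 8 * (klE4X0 + 1) + (2 + 72 * c₂)) ^ 2 *
        (Real.exp 1 ^ 5 * (klE4KapF R * |U| + 2 * (c / Real.log 4) * klE4Mom R) +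
          4 * Real.exp 1 ^ 9 * (Real.sqrt (2 * (7 + 6047)) + Real.sqrt 6047) ^ 2 * |U|)) ≤ A₀) :
    SourceProfilesAtLevF L M (klSrcBudget P Q U (fun _ _ => A₀) 1) β U μ K (srcWindowFamily L M) 0 0 1 :=
  sourceProfilesAtLevF_of_forall fun s _ _ m q w =>
    klSrcPinnedSumAtF_srcWindow_le_of_fibre (B := fun s m => klSrcBudget P Q U (fun _ _ => A₀) 1 s m)
      (srcPinnedSumW_one_klSrcBudget_of_le_CE hCT0 hCT hc₂ P R c hP hR hc hc₆ μ hμ U hU hU₆ β hβ hβc K hK L M hL hM hAbar1 hAbar hθ1 hθ2 Q hCE hA₀)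
      s m q w

/-- **HUV-W LEVEL 0 in the lead's currency, PACKAGED (frame-generic)** — for every well-formed `P R`: a `CE`-threshold `CE₀ ≥ 0`, doors `c₀`, `U₀`,
and in the regime an L-free amplitude `A₀ ≥ 1` (after `β`), such that at every volume above `(klEngL₃, klEngM₃)`, for EVERY admissible frame `K` and
every package `Q` with `CE₀ ≤ Q.CE`: `SourceProfilesAtLevF L M (klSrcBudget P Q U (fun _ _ => A₀) 1) β U μ K (srcWindowFamily L M) 0 0 1`.
(`A₀`, the thresholds and `CE₀` are `K`-free; the VL producer takes `K := K_top` with `FrameOK` from its tower hypothesis.)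
[cite: BenfattoGiulianiMastropietro2006, §2.9 (4.3)–(4.8), §3 (3.2)–(3.8)] -/
theorem exists_sourceProfilesAtLevF_srcWindow_zero (P : SplitConsts) (R : RenConsts) (hP : P.WF) (hR : R.WF2) :
    ∃ CE₀ : ℝ, 0 ≤ CE₀ ∧ ∃ c₀ : ℝ, 0 < c₀ ∧ ∀ c : ℝ, 0 < c → c ≤ c₀ → ∃ U₀ : ℝ, 0 < U₀ ∧
      ∀ μ ∈ klWindowC, ∀ U : ℝ, 0 < U → U ≤ U₀ → ∀ β : ℝ, klBetaMin ≤ β → β ≤ Real.exp (c / U ^ 2) →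
        ∃ A₀ : ℝ, 1 ≤ A₀ ∧ ∀ (L M : ℕ) [NeZero L] [NeZero M], klEngL₃ β U ≤ L → klEngM₃ β U L ≤ M →
          ∀ K : TrigPolyC4v, FrameOK R U (nScales β) μ K → ∀ Q : EngConsts, CE₀ ≤ Q.CE →
            SourceProfilesAtLevF L M (klSrcBudget P Q U (fun _ _ => A₀) 1) β U μ K (srcWindowFamily L M) 0 0 1 := by
  obtain ⟨CE₀, hCE₀, c₀, hc₀, h⟩ := exists_srcPinnedSumW_one_klSrcBudget P R hP hR
  refine ⟨CE₀, hCE₀, c₀, hc₀, fun c hc hcc₀ => ?_⟩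
  obtain ⟨U₀, hU₀, h'⟩ := h c hc hcc₀
  refine ⟨U₀, hU₀, fun μ hμ U hU hUU₀ β hβ hβc => ?_⟩
  obtain ⟨A₀, hA₀, h''⟩ := h' μ hμ U hU hUU₀ β hβ hβc
  refine ⟨A₀, hA₀, fun L M _ _ hL hM K hK Q hQ => ?_⟩
  exact sourceProfilesAtLevF_of_forall fun s _ _ m q w =>
    klSrcPinnedSumAtF_srcWindow_le_of_fibre (B := fun s m => klSrcBudget P Q U (fun _ _ => A₀) 1 s m) (h'' L M hL hM K hK Q hQ) s m q w

end Summit.HubbardSuperconductivity.HubbardSuperconductivity.Theorems.EngineV8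

end
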